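import Literature.Analysis.FunctionSpaces.TorusAxisAverageCalculus
import Summits.AnomalousDissipation.AnomalousDissipation.Theses.ImpulseGrid

/-!
# Route ImpulseGrid (AnomalousDissipation) — slab ⊗ transverse factorization

Stub `stub_slabFactorization` (S2b) of line `SketchIdeator2` for the crux
`Summit.AnomalousDissipation.AnomalousDissipation.Theses.ImpulseGrid.GridSigns`
(item `stmt-AnomalousDissipation-1771`).

On the unit three-torus `T³ = UnitAddTorus (Fin 3)` (volume = product Haar probability measure),
a continuous weight `a` depending on `x₀` only (encoded as invariance under all translations along
the axes `1` and `2`) integrates against the energy density of a continuous `x₀`-independent field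
`G` (invariance along the axis `0`) as a product:

`∫ a ‖G‖² = (∫ a) (∫ ‖G‖²)`.

Proof (Fubini along the measure-preserving axis shear, through the tree's axis-average kit
`Literature/Analysis/FunctionSpaces/TorusAxisAverage(Calculus)`): the pairing identity
`∫ ⟪A, B⟫ = ∫ ⟪A, axisAvg 0 B⟫` for the `0`-invariant field `A = ‖G‖²` (and for `A = 1`) reduces
both sides to integrals against the axis-`0` average `axisAvg 0 a`, which is a constant `K`:
it is invariant along the axis `0` (translation invariance of the Haar integral) and along the
axes `1`, `2` (invariance of `a`, the translations commute), and every point of `T³` is a sum of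
three axis translates of the origin. Hence `∫ a ‖G‖² = K ∫ ‖G‖²` and `∫ a = K`.

No new definitions.
-/

noncomputable section

-- `Summit.<Summit>.<Problem>` is the tree's mandated summit-side namespace (CONVENTIONS §2); for this
-- single-conjunct summit the two coincide, so the duplicate is deliberate.
set_option linter.dupNamespace false

open MeasureTheory Set Filter Topology
open scoped InnerProductSpace RealInnerProductSpace

namespace Summit.AnomalousDissipation.AnomalousDissipation.Theorems.GridSignsCeilings

open Literature.Analysis
open Literature.Analysis.FluidPDE Literature.Analysis.FluidPDE.Torus
open Literature.Analysis.FunctionSpaces Literature.Analysis.FunctionSpaces.Torus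
open Summit.AnomalousDissipation.AnomalousDissipation.Theses.ImpulseGrid

/-- The axis-`0` average of a weight on `T³` that is invariant under the translations along the
axes `1` and `2` is constant: it is invariant along all three axes, and every point is a sum of
three axis translates of the origin. [folklore] -/
theorem axisAvg_zero_apply_eq_of_slab {a : UnitAddTorus (Fin 3) → ℝ}
    (ha : ∀ (s : UnitAddCircle) x, a (x + Pi.single (1 : Fin 3) s) = a x ∧
      a (x + Pi.single (2 : Fin 3) s) = a x)
    (x : UnitAddTorus (Fin 3)) : axisAvg (0 : Fin 3) a x = axisAvg (0 : Fin 3) a 0 := by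
  -- invariance of the average along the axes `1` and `2` (the translations commute)
  have h1 : ∀ (s : UnitAddCircle) (y : UnitAddTorus (Fin 3)),
      axisAvg (0 : Fin 3) a (y + Pi.single (1 : Fin 3) s) = axisAvg (0 : Fin 3) a y := by
    intro s y
    simp only [axisAvg_apply]
    refine integral_congr_ae (ae_of_all _ fun t => ?_)
    dsimp only
    rw [add_right_comm]
    exact (ha s _).1
  have h2 : ∀ (s : UnitAddCircle) (y : UnitAddTorus (Fin 3)),
      axisAvg (0 : Fin 3) a (y + Pi.single (2 : Fin 3) s) = axisAvg (0 : Fin 3) a y := by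
    intro s y
    simp only [axisAvg_apply]
    refine integral_congr_ae (ae_of_all _ fun t => ?_)
    dsimp only
    rw [add_right_comm]
    exact (ha s _).2
  -- every point is a sum of three axis translates of the origin
  have hx : x = 0 + Pi.single (0 : Fin 3) (x 0) + Pi.single (1 : Fin 3) (x 1)
      + Pi.single (2 : Fin 3) (x 2) := by
    have h := (Finset.univ_sum_single x).symm
    rw [Fin.sum_univ_three] at h
    rw [zero_add]
    exact h
  rw [hx, h2, h1, axisAvg_add_single]

/-- **Stub S2b (slab ⊗ transverse factorization).** On `T³`, a continuous weight depending on
`x₀` only integrates against the energy density of a continuous `x₀`-independent field as a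
product: `∫ a ‖G‖² = (∫ a)(∫ ‖G‖²)` (Fubini along the measure-preserving axis shear; the tree's
`Torus.axisAvg` kit). With `a = Φ·H` and `∫ΦH = 1/2` this is the free half-kick `‖G‖²/2`. [folklore] -/
theorem stub_slabFactorization :
    ∀ (a : UnitAddTorus (Fin 3) → ℝ) (G : UnitAddTorus (Fin 3) → EuclideanSpace ℝ (Fin 3)),
      Continuous a → Continuous G →
      (∀ (s : UnitAddCircle) x, a (x + Pi.single (1 : Fin 3) s) = a x ∧ a (x + Pi.single (2 : Fin 3) s) = a x) →
      (∀ (s : UnitAddCircle) x, G (x + Pi.single (0 : Fin 3) s) = G x) →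
      ∫ x, a x * ‖G x‖ ^ 2 = (∫ x, a x) * ∫ x, ‖G x‖ ^ 2 := by
  intro a G ha hG hainv hGinv
  -- the axis-`0` average of `a` is the constant `K`
  set K : ℝ := axisAvg (0 : Fin 3) a 0 with hK
  have hconst : ∀ x, axisAvg (0 : Fin 3) a x = K := fun x => axisAvg_zero_apply_eq_of_slab hainv x
  -- `a` is bounded and integrable, `‖G‖²` is continuous
  obtain ⟨C, hC⟩ : ∃ C : ℝ, ∀ x, ‖a x‖ ≤ C := by
    obtain ⟨C, hC⟩ := isCompact_univ.exists_bound_of_continuousOn ha.continuousOn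
    exact ⟨C, fun x => hC x (mem_univ x)⟩
  have haint : Integrable a volume := ha.integrable_unitAddTorus
  have hGn : Continuous fun x => ‖G x‖ ^ 2 := hG.norm.pow 2
  -- pairing identity with `A := ‖G‖²`, `B := a`
  have hpair : ∫ x, ⟪‖G x‖ ^ 2, a x⟫_ℝ = ∫ x, ⟪‖G x‖ ^ 2, axisAvg (0 : Fin 3) a x⟫_ℝ :=
    integral_inner_eq_integral_inner_axisAvg (0 : Fin 3) (A := fun x => ‖G x‖ ^ 2) (B := a)
      (fun s x => by simp only [hGinv]) hGn.aestronglyMeasurable haint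
      (integrable_inner_shift_of_bound 0 hGn.integrable_unitAddTorus ha.aestronglyMeasurable hC)
  -- pairing identity with `A := 1`, `B := a`
  have hone : ∫ x, ⟪(1 : ℝ), a x⟫_ℝ = ∫ x, ⟪(1 : ℝ), axisAvg (0 : Fin 3) a x⟫_ℝ :=
    integral_inner_eq_integral_inner_axisAvg (0 : Fin 3) (A := fun _ => (1 : ℝ)) (B := a)
      (fun s x => rfl) aestronglyMeasurable_const haint
      (integrable_inner_shift_of_bound 0 (integrable_const _) ha.aestronglyMeasurable hC)
  simp only [hconst, RCLike.inner_apply, RCLike.conj_to_real, map_one, mul_one] at hpair hone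
  rw [hpair, hone, integral_const_mul, integral_const, smul_eq_mul, probReal_univ, one_mul]

end Summit.AnomalousDissipation.AnomalousDissipation.Theorems.GridSignsCeilings
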